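import Summits.CriticalPhenomena.PercolationContinuityZ3.Theorems.PercNearOneGluingNoHeavyLowerTailGiantExchange
import Summits.CriticalPhenomena.PercolationContinuityZ3.Theorems.PercNearOneGluingNoHeavyLowerTailOwnConnection
import Literature.Probability.Percolation.TwoSetExchange
import Literature.Probability.Percolation.LonelyClusterExchange
import HarnessLib

/-!
# `NoHeavyLowerTail` (stmt-CriticalPhenomena-4575) — every SINGLE-SET HALL CUT of the attached-champion transport holds

Support file (prover `prim-lf-7`, lemma factory "k-cluster conditional association"; `--supports stmt-CriticalPhenomena-4575`).
No definitions, no named facts, no sorries.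

Setting: bond percolation `μ = prodBernoulli w` on a finite vertex type, relays `A` with `|A| ≤ 2j+1` (the crux ladder
`|A| ∈ {2j, 2j+1}` and below: at most one heavy cluster), observer `o`, `π(v) = {a ∈ A : v ↔ a}`, `N = |π(o)|`,
"light" `= |π| ≤ j`, "heavy" `= |π| ≥ j+1`.  The open (5,2) residual of the crux in its attached-champion form XZ = CST
(`stub_attachedChampion`) is `μ(1 ≤ N ≤ j, c heavy) ≤ μ(N ≥ j+1, c light)` for a champion `c`; prim-lf-4 (LP duality) rewrote it
as a TRANSPORT problem between the atoms `dem(B) := μ(π(o) = B, c heavy)` (`1 ≤ |B| ≤ j`) and the "giant" atoms, whose Hall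
cuts for single sets are

  `dem(B) ≤ cap(B) := μ(B ⊆ π(o), N ≥ j+1, c light)`      ("PS1" for `|B| = 1`, "PD1" for `|B| = 2`; alive in every census).

* `transportCut_le` — **THEOREM: `dem(B) ≤ cap(B)` for every `B ⊆ A` with `|B| ≤ j` containing a relay `y` with
  `μ(y light) ≤ μ(c light)`** (in particular for a champion `c` and every `B ∌ c`).  Proof (k-cluster conditional association):
  (1) the two-SET exchange of van den Berg–Häggström–Kahn (`Literature.setTwoClusterExchange`, `S = B ∪ {o}`, `T = {c}`) with the
  cardinality-typed events `A₁ = {o ↔ B}` (+), `A₂ = {U ≥ j+1}` (+), `B₁ = {U ≤ |B|} ∩ {c heavy}` (−), `U := #`relays joined to `B ∪ {o}`,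
  gives `dem(B) · μ(c ↮ B∪{o}, U ≥ j+1) ≤ cap(B) · μ(c ↮ B∪{o}, c heavy)`;
  (2) the observer-SET transfer `Literature.observerSet_le_of_lonelier` (BHK 1.5 again) with `O = B ∪ {o}` gives, after complementation
  inside `{c ↮ O}`, `μ(c ↮ O, c heavy) ≤ μ(c ↮ O, U ≥ j+1)`.
  The UNION cuts of the transport (several pockets at once) are not covered; they are the remaining content of XZ.
-/

noncomputable section

namespace Summit.CriticalPhenomena.PercolationContinuityZ3.Theorems

open MeasureTheory Set Literature.Probability.LatticeModels Literature.Probability.Percolation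
open scoped Classical

open GiantExchange

variable {V : Type*}

/-- **Every single-set Hall cut of the attached-champion transport (PROVED, `|A| ≤ 2j+1`).**  Let `B ⊆ A` with `|B| ≤ j`
contain a relay `y` with `μ(y light) ≤ μ(c light)` (e.g. `c` a champion).  Then
`μ(π(o) = B, c heavy) ≤ μ(B ⊆ π(o), |π(o)| ≥ j+1, c light)` — the demand of the light pocket `B` is covered by the giant pockets
through `B` with `c` outside.  For `|B| = 1` this is prim-lf-4's "PS1", for `|B| = 2` its open "PD1".
[cite: VandenbergHaggstromKahn2005, Thm. 2.1 (p. 9) at q = 1 — corollary via `setTwoClusterExchange` and `observerSet_le_of_lonelier`, derived in this file] -/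
theorem transportCut_le [Fintype V] (w : Sym2 V → unitInterval) (A B : Finset V) (o c y : V) (j : ℕ)
    (hA : A.card ≤ 2 * j + 1) (hBA : B ⊆ A) (hBj : B.card ≤ j) (hy : y ∈ B)
    (hle : (prodBernoulli w).real {ω : BondConfig V | (A.filter fun a => ω ∈ openConn y a).card ≤ j} ≤
      (prodBernoulli w).real {ω : BondConfig V | (A.filter fun a => ω ∈ openConn c a).card ≤ j}) :
    (prodBernoulli w).real ({ω : BondConfig V | (A.filter fun a => ω ∈ openConn o a) = B} ∩
        {ω | j + 1 ≤ (A.filter fun a => ω ∈ openConn c a).card}) ≤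
      (prodBernoulli w).real ({ω : BondConfig V | B ⊆ A.filter fun a => ω ∈ openConn o a} ∩
        {ω | j + 1 ≤ (A.filter fun a => ω ∈ openConn o a).card} ∩
        {ω | (A.filter fun a => ω ∈ openConn c a).card ≤ j}) := by
  set μ := prodBernoulli w with hμ
  -- the two groups
  set O : Finset V := insert o B with hO
  set S : Set V := (↑O : Set V) with hS
  set T : Set V := {c} with hT
  have hoS : o ∈ S := by rw [hS, hO]; exact Finset.mem_coe.2 (Finset.mem_insert_self o B)
  have hBS : ∀ v ∈ B, v ∈ S := fun v hv => by rw [hS, hO]; exact Finset.mem_coe.2 (Finset.mem_insert_of_mem hv)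
  have hcT : c ∈ T := by rw [hT]; exact mem_singleton c
  -- the union relay count of `C_S`
  let U : BondConfig V → ℕ := fun ω => (A.filter fun a => a ∈ S ∨ ∃ e ∈ ⋃ s ∈ S, openEdgeCluster ω s, a ∈ e).card
  have hU : ∀ ω : BondConfig V, U ω = (A.filter fun a => ∃ s ∈ S, (openGraph ω).Reachable s a).card := by
    intro ω
    show (A.filter fun a => a ∈ S ∨ ∃ e ∈ ⋃ s ∈ S, openEdgeCluster ω s, a ∈ e).card = _
    rw [Finset.filter_congr (fun a _ => unionCount_iff S ω a)]
  -- events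
  set A₁ : Set (BondConfig V) := ⋂ v ∈ B, (openConn o v : Set (BondConfig V)) with hA₁
  set A₂ : Set (BondConfig V) := {ω | j + 1 ≤ U ω} with hA₂
  set B₁ : Set (BondConfig V) := {ω | U ω ≤ B.card} ∩ {ω | j + 1 ≤ (A.filter fun a => ω ∈ openConn c a).card} with hB₁
  set D' : Set (BondConfig V) := {ω : BondConfig V | ∀ s ∈ S, ∀ t ∈ T, ¬ (openGraph ω).Reachable s t} with hD'
  have hD : ∀ ω : BondConfig V, ω ∈ D' ↔ ∀ s ∈ S, ¬ (openGraph ω).Reachable s c := by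
    intro ω; rw [hD', hT]; simp only [mem_setOf_eq, mem_singleton_iff, forall_eq]
  -- monotonicity of U in C_S
  have hUmono : ∀ ⦃ω ω' : BondConfig V⦄, (⋃ s ∈ S, openEdgeCluster ω s) ⊆ (⋃ s ∈ S, openEdgeCluster ω' s) → U ω ≤ U ω' := by
    intro ω ω' h
    apply Finset.card_le_card
    intro a ha
    rw [Finset.mem_filter] at ha ⊢
    exact ⟨ha.1, ha.2.imp_right fun ⟨e, he, hae⟩ => ⟨e, h he, hae⟩⟩
  -- the set exchange (BHK 2006 Thm 2.1 at q = 1)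
  have key := setTwoClusterExchange w S T (A₁ := A₁) (A₂ := A₂) (B₁ := B₁) (B₂ := univ)
    (by
      intro ω ω' hs ht hω
      rw [hA₁] at hω ⊢
      simp only [mem_iInter] at hω ⊢
      exact fun v hv => TwoSetExchange.typePlus_openConn_of_mem S T hoS v hs ht (hω v hv))
    (by intro ω ω' hs _ hω; exact le_trans hω (hUmono hs))
    (by
      intro ω ω' hs ht hω
      have hc : openEdgeCluster ω c ⊆ openEdgeCluster ω' c := TwoSetExchange.openEdgeCluster_mono_of_biUnion hcT ht
      refine ⟨show U ω' ≤ B.card from le_trans (hUmono hs) hω.1,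
        show j + 1 ≤ (A.filter fun a => ω' ∈ openConn c a).card from le_trans hω.2 ?_⟩
      apply Finset.card_le_card
      intro a ha
      rw [Finset.mem_filter] at ha ⊢
      refine ⟨ha.1, ?_⟩
      change (openGraph ω').Reachable c a
      rw [reachable_iff_exists_mem_openEdgeCluster]
      rcases (reachable_iff_exists_mem_openEdgeCluster ω c a).1 ha.2 with h1 | ⟨e, he, hve⟩
      · exact Or.inl h1
      · exact Or.inr ⟨e, hc he, hve⟩)
    (fun _ _ _ _ _ => mem_univ _)
  simp only [inter_univ] at key
  -- the four events of the statement
  set dem := μ.real ({ω : BondConfig V | (A.filter fun a => ω ∈ openConn o a) = B} ∩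
        {ω | j + 1 ≤ (A.filter fun a => ω ∈ openConn c a).card}) with hdem
  set cap := μ.real ({ω : BondConfig V | B ⊆ A.filter fun a => ω ∈ openConn o a} ∩
        {ω | j + 1 ≤ (A.filter fun a => ω ∈ openConn o a).card} ∩
        {ω | (A.filter fun a => ω ∈ openConn c a).card ≤ j}) with hcap
  -- `Hsep` = {c ↮ O, c heavy} in the form of `observerSet_le_of_lonelier`
  set Hsep : Set (BondConfig V) := {ω : BondConfig V | (∀ x ∈ O, ω ∉ openConn c x) ∧
      j + 1 ≤ (A.filter fun a => ω ∈ openConn c a).card} with hHsep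
  -- (a) demSet ⊆ D' ∩ (A₁ ∩ B₁)
  have ha : ({ω : BondConfig V | (A.filter fun a => ω ∈ openConn o a) = B} ∩
      {ω | j + 1 ≤ (A.filter fun a => ω ∈ openConn c a).card}) ⊆ D' ∩ (A₁ ∩ B₁) := by
    rintro ω ⟨hpo, hc⟩
    simp only [mem_setOf_eq] at hpo hc
    have hov : ∀ v ∈ B, (openGraph ω).Reachable o v := fun v hv => by
      have : v ∈ A.filter fun a => ω ∈ openConn o a := by rw [hpo]; exact hv
      exact (Finset.mem_filter.1 this).2
    have hoc : ¬ (openGraph ω).Reachable o c := by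
      intro h
      have := card_eq_of_reachable A h
      rw [hpo] at this; omega
    refine ⟨(hD ω).2 fun s hs => ?_, ?_, ⟨?_, hc⟩⟩
    · rw [hS, hO, Finset.coe_insert, mem_insert_iff, Finset.mem_coe] at hs
      rcases hs with rfl | hs
      · exact hoc
      · exact fun h => hoc ((hov s hs).trans h)
    · rw [hA₁]; simp only [mem_iInter]; exact hov
    · show U ω ≤ B.card
      rw [hU ω]
      apply Finset.card_le_card
      intro a ha
      rw [Finset.mem_filter] at ha
      obtain ⟨s, hs, hsa⟩ := ha.2
      have hoa : (openGraph ω).Reachable o a := by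
        rw [hS, hO, Finset.coe_insert, mem_insert_iff, Finset.mem_coe] at hs
        rcases hs with rfl | hs
        · exact hsa
        · exact (hov s hs).trans hsa
      have : a ∈ A.filter fun a => ω ∈ openConn o a := Finset.mem_filter.2 ⟨ha.1, hoa⟩
      rw [hpo] at this; exact this
  -- (b) D' ∩ (A₁ ∩ A₂) ⊆ capSet
  have hb : D' ∩ (A₁ ∩ A₂) ⊆ ({ω : BondConfig V | B ⊆ A.filter fun a => ω ∈ openConn o a} ∩
        {ω | j + 1 ≤ (A.filter fun a => ω ∈ openConn o a).card} ∩
        {ω | (A.filter fun a => ω ∈ openConn c a).card ≤ j}) := by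
    rintro ω ⟨hDω, h1, h2⟩
    rw [hA₁] at h1; simp only [mem_iInter] at h1
    have hov : ∀ v ∈ B, (openGraph ω).Reachable o v := h1
    have hUo : U ω = (A.filter fun a => ω ∈ openConn o a).card := by
      rw [hU ω]; congr 1
      apply Finset.filter_congr
      intro a _
      constructor
      · rintro ⟨s, hs, hsa⟩
        rw [hS, hO, Finset.coe_insert, mem_insert_iff, Finset.mem_coe] at hs
        rcases hs with rfl | hs
        · exact hsa
        · exact (hov s hs).trans hsa
      · intro h; exact ⟨o, hoS, h⟩
    have hoin : j + 1 ≤ (A.filter fun a => ω ∈ openConn o a).card := by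
      have : j + 1 ≤ U ω := h2
      rwa [hUo] at this
    have hoc : ¬ (openGraph ω).Reachable c o := fun h => (hD ω).1 hDω o hoS h.symm
    refine ⟨⟨?_, hoin⟩, light_of_not_reachable_of_heavy A hA hoc hoin⟩
    intro v hv
    exact Finset.mem_filter.2 ⟨hBA hv, hov v hv⟩
  -- (c) D' ∩ B₁ ⊆ Hsep
  have hc' : D' ∩ B₁ ⊆ Hsep := by
    rintro ω ⟨hDω, -, h2⟩
    refine ⟨fun x hx h => (hD ω).1 hDω x (by rw [hS]; exact Finset.mem_coe.2 hx) h.symm, h2⟩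
  -- (d) μ(Hsep) ≤ μ(D' ∩ A₂) via the observer-set transfer
  have hyO : y ∈ O := Finset.mem_insert_of_mem hy
  have hOS := observerSet_le_of_lonelier w A O y c hyO j hle
  -- {c ↮ O} splits by |π(O)| ≤ j / ≥ j+1 and by c light / heavy; 1 ≤ |π(O)| always (y ∈ π(O))
  set Osep : Set (BondConfig V) := {ω : BondConfig V | ∀ x ∈ O, ω ∉ openConn c x} with hOsep
  have e1 : {ω : BondConfig V | (∀ x ∈ O, ω ∉ openConn c x) ∧
      1 ≤ (A.filter fun z => ∃ x ∈ O, ω ∈ openConn x z).card ∧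
        (A.filter fun z => ∃ x ∈ O, ω ∈ openConn x z).card ≤ j} =
      Osep ∩ {ω | (A.filter fun z => ∃ x ∈ O, ω ∈ openConn x z).card ≤ j} := by
    ext ω; simp only [mem_setOf_eq, mem_inter_iff, hOsep]
    constructor
    · rintro ⟨h1, -, h3⟩; exact ⟨h1, h3⟩
    · rintro ⟨h1, h3⟩
      refine ⟨h1, Finset.card_pos.2 ⟨y, Finset.mem_filter.2 ⟨hBA hy, y, hyO, ?_⟩⟩, h3⟩
      exact SimpleGraph.Reachable.refl y
  have e2 : {ω : BondConfig V | (∀ x ∈ O, ω ∉ openConn c x) ∧ (A.filter fun z => ω ∈ openConn c z).card ≤ j} =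
      Osep ∩ {ω | (A.filter fun z => ω ∈ openConn c z).card ≤ j} := by
    ext ω; simp only [mem_setOf_eq, mem_inter_iff, hOsep]
  rw [e1, e2] at hOS
  have sO1 := OwnDisconnection.split w Osep {ω | (A.filter fun z => ∃ x ∈ O, ω ∈ openConn x z).card ≤ j}
  have sO2 := OwnDisconnection.split w Osep {ω | (A.filter fun z => ω ∈ openConn c z).card ≤ j}
  have eH : Hsep = Osep ∩ {ω | (A.filter fun z => ω ∈ openConn c z).card ≤ j}ᶜ := by
    ext ω; simp only [hHsep, hOsep, mem_inter_iff, mem_setOf_eq, mem_compl_iff, not_le]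
    constructor
    · rintro ⟨h1, h2⟩; exact ⟨h1, by omega⟩
    · rintro ⟨h1, h2⟩; exact ⟨h1, by omega⟩
  have eD : D' ∩ A₂ = Osep ∩ {ω | (A.filter fun z => ∃ x ∈ O, ω ∈ openConn x z).card ≤ j}ᶜ := by
    ext ω
    simp only [mem_inter_iff, mem_compl_iff, mem_setOf_eq, hOsep, hD ω, not_le]
    constructor
    · rintro ⟨h1, h2⟩
      refine ⟨fun x hx h => h1 x (by rw [hS]; exact Finset.mem_coe.2 hx) h.symm, ?_⟩
      have : j + 1 ≤ U ω := h2
      rw [hU ω] at this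
      have e : (A.filter fun a => ∃ s ∈ S, (openGraph ω).Reachable s a) =
          A.filter fun z => ∃ x ∈ O, ω ∈ openConn x z := by
        apply Finset.filter_congr; intro a _
        simp only [hS, Finset.mem_coe, openConn, mem_setOf_eq]
      rw [e] at this; omega
    · rintro ⟨h1, h2⟩
      refine ⟨fun s hs h => h1 s (by rw [hS] at hs; exact Finset.mem_coe.1 hs) h.symm, ?_⟩
      show j + 1 ≤ U ω
      rw [hU ω]
      have e : (A.filter fun a => ∃ s ∈ S, (openGraph ω).Reachable s a) =
          A.filter fun z => ∃ x ∈ O, ω ∈ openConn x z := by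
        apply Finset.filter_congr; intro a _
        simp only [hS, Finset.mem_coe, openConn, mem_setOf_eq]
      rw [e]; omega
  have hd : μ.real Hsep ≤ μ.real (D' ∩ A₂) := by
    rw [eH, eD]; linarith
  -- assemble
  have hdem_le : dem ≤ μ.real (D' ∩ (A₁ ∩ B₁)) := measureReal_mono ha (measure_ne_top _ _)
  have hcap_ge : μ.real (D' ∩ (A₁ ∩ A₂)) ≤ cap := measureReal_mono hb (measure_ne_top _ _)
  have hB₁_le : μ.real (D' ∩ B₁) ≤ μ.real (D' ∩ A₂) :=
    le_trans (measureReal_mono hc' (measure_ne_top _ _)) hd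
  have h0 : 0 ≤ μ.real (D' ∩ A₂) := measureReal_nonneg
  have hcap0 : 0 ≤ cap := measureReal_nonneg
  rcases h0.eq_or_lt with hz | hpos
  · -- μ(D' ∩ A₂) = 0 ⇒ μ(Hsep) = 0 ⇒ dem = 0
    have hdemH : dem ≤ μ.real Hsep :=
      le_trans hdem_le (measureReal_mono (fun ω hω => hc' ⟨hω.1, hω.2.2⟩) (measure_ne_top _ _))
    have : dem ≤ 0 := by linarith
    linarith
  · have h1 : dem * μ.real (D' ∩ A₂) ≤ cap * μ.real (D' ∩ A₂) :=
      calc dem * μ.real (D' ∩ A₂) ≤ μ.real (D' ∩ (A₁ ∩ B₁)) * μ.real (D' ∩ A₂) :=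
            mul_le_mul_of_nonneg_right hdem_le h0
        _ ≤ μ.real (D' ∩ (A₁ ∩ A₂)) * μ.real (D' ∩ B₁) := key
        _ ≤ cap * μ.real (D' ∩ A₂) := mul_le_mul hcap_ge hB₁_le measureReal_nonneg hcap0
    exact le_of_mul_le_mul_right h1 hpos

end Summit.CriticalPhenomena.PercolationContinuityZ3.Theorems

end
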